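import Literature.Geometry.Lorentzian.RadialCausalCone
import Literature.Geometry.Lorentzian.CausalFutureProofs
import Mathlib.Analysis.InnerProductSpace.Calculus
import Mathlib.Analysis.InnerProductSpace.EuclideanDist
import Mathlib.Analysis.Normed.Module.HahnBanach
import Mathlib.Analysis.Calculus.Deriv.Slope
import HarnessLib

/-!
# Local Lorentz geometry in a normal exponential chart, II: null rigidity
(O'Neill 1983, Ch. 5, Lemma 5.33 / Prop. 5.34, causal case; Ch. 10, Prop. 10.46, local form)

Continuation of `RadialCausalCone.lean`. Setting: `(M, g, τ)` a time-oriented Lorentzian manifold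
(Hausdorff, without boundary, `∞ ≤ n`), `o ∈ M`, `exp_o` the exponential map on `𝓔_o ⊆ T_oM = E`,
`β : [a, b] → 𝓔_o` differentiable with `α = exp_o ∘ β` future causal, and `β` valued in the CLOSED
future causal cone of `T_oM` with `β(a) = 0` (the curve starts at `o`). By
`radial_causalcone_antitone`, `g_o(β, β)` is nonincreasing, so it vanishes identically as soon as
`g_o(β(b), β(b)) = 0`. **Null rigidity** (`radial_null_rigidity`): in that case `β` runs
monotonically along a single null ray of `T_oM` — there are a future null `ℓ ∈ T_oM` and a
strictly increasing continuous `θ : [a, b] → ℝ`, `θ(a) = 0`, with `β(t) = θ(t) ℓ`, and every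
derivative `β'(t)` is a positive multiple of `ℓ`; consequently `α` is a monotone reparametrisation
of the radial null geodesic `s ↦ exp_o(sℓ)` (`radial_null_rigidity_velocity`: the velocities of `α`
are positive multiples of the velocities of that geodesic). This is the rigidity half of O'Neill's
Prop. 10.46 ("if `α` is a causal curve that is not a null pregeodesic then there is a timelike
curve from `p` to `q`"), in the exponential chart and for differentiable curves: the computation
is `0 = d g_o(β,β)/dt = 2 g(α', P)` (Gauss lemma), whence `α' ∥ P` (a future causal vector
orthogonal to a future null one is proportional to it, equality case of the reverse Cauchy–Schwarz
inequality, O'Neill Ch. 5, p. 144), whence `β' ∥ β` through the injectivity of `d(exp_o)_β`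
(hypothesis `hinj`, supplied by normal neighbourhoods downstream), and a curve with `β' ∥ β` keeps a
constant direction (`exists_ne_zero_smul_of_hasDerivAt_smul`, elementary calculus: the vector
`(⟪β, ℓ⟫/⟪β, β⟫) β` has zero derivative).

Everything is proved; no definitions and no named facts are introduced (D-0026). Layer L0 (iv)
of the programme for `ChruscielEtAl2001_areaTheorem`.

## References

* B. O'Neill, *Semi-Riemannian geometry with applications to relativity*, Academic Press 1983,
  Ch. 5, Lemma 5.33, Prop. 5.34 (pp. 146–147), Prop. 5.30 (p. 144); Ch. 10, Prop. 10.46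
  (p. 294). [ONeillSemiRiemannian1983]
-/

noncomputable section

open Bundle Set Filter Function
open scoped Manifold ContDiff Topology RealInnerProductSpace

namespace Literature.Geometry.Lorentzian

open Literature.Geometry.Riemannian

/-! ### Calculus: a curve with `β' ∥ β` keeps a constant direction -/

section Direction

variable {F : Type*} [NormedAddCommGroup F] [InnerProductSpace ℝ F]

/-- **A nowhere-vanishing curve with `β' = c β` has constant direction** (inner product space
form): if `β' t = c(t) β t` and `β t ≠ 0` for all `t ∈ [a, b]`, then every `β t` is a nonzero
multiple of `β a`. Proof: the vector `q = (⟪β, ℓ⟫ / ⟪β, β⟫) β`, `ℓ = β a`, has zero derivative on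
`[a, b]`, hence is constantly `q(a) = ℓ`. (No regularity of `c` is needed.) [folklore] -/
theorem exists_ne_zero_smul_of_hasDerivAt_smul_inner {β : ℝ → F} {c : ℝ → ℝ} {a b : ℝ}
    (hβ : ∀ t ∈ Icc a b, HasDerivAt β (c t • β t) t) (hne : ∀ t ∈ Icc a b, β t ≠ 0)
    {t : ℝ} (ht : t ∈ Icc a b) : ∃ μ : ℝ, μ ≠ 0 ∧ β t = μ • β a := by
  have hab : a ≤ b := ht.1.trans ht.2
  set ℓ : F := β a with hℓ
  set u : ℝ → ℝ := fun s ↦ ⟪β s, ℓ⟫ with hu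
  set w : ℝ → ℝ := fun s ↦ ⟪β s, β s⟫ with hw
  set q : ℝ → F := fun s ↦ (u s / w s) • β s with hq
  have hw0 : ∀ s ∈ Icc a b, w s ≠ 0 := fun s hs ↦ by
    simp only [hw]
    rw [real_inner_self_eq_norm_sq]
    exact pow_ne_zero 2 (norm_ne_zero_iff.2 (hne s hs))
  -- derivatives of `u`, `w`, `u / w` and `q`
  have hq' : ∀ s ∈ Icc a b, HasDerivAt q 0 s := by
    intro s hs
    have hu' : HasDerivAt u (c s * u s) s := by
      have h := HasDerivAt.inner ℝ (hβ s hs) (hasDerivAt_const s ℓ)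
      have h2 : ⟪β s, (0 : F)⟫ + ⟪c s • β s, ℓ⟫ = c s * u s := by
        rw [inner_zero_right, real_inner_smul_left, zero_add]
      rw [h2] at h
      exact h
    have hw' : HasDerivAt w (2 * c s * w s) s := by
      have h := HasDerivAt.inner ℝ (hβ s hs) (hβ s hs)
      have h2 : ⟪β s, c s • β s⟫ + ⟪c s • β s, β s⟫ = 2 * c s * w s := by
        rw [real_inner_smul_right, real_inner_smul_left]
        ring
      rw [h2] at h
      exact h
    have hr' : HasDerivAt (fun s ↦ u s / w s) (-(c s) * (u s / w s)) s := by
      have h := hu'.div hw' (hw0 s hs)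
      have h2 : (c s * u s * w s - u s * (2 * c s * w s)) / w s ^ 2 = -(c s) * (u s / w s) := by
        field_simp [hw0 s hs]
        ring
      rw [h2] at h
      exact h
    have h := hr'.smul (hβ s hs)
    have h2 : (u s / w s) • (c s • β s) + (-(c s) * (u s / w s)) • β s = 0 := by
      rw [smul_smul, ← add_smul]
      have : u s / w s * c s + -c s * (u s / w s) = 0 := by ring
      rw [this, zero_smul]
    rw [h2] at h
    exact h
  -- `q` is constant on `[a, b]`, equal to `q a = ℓ`
  have hqc : ContinuousOn q (Icc a b) := fun s hs ↦ (hq' s hs).continuousAt.continuousWithinAt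
  have hconst := constant_of_has_deriv_right_zero hqc
    (fun s hs ↦ ((hq' s ⟨hs.1, hs.2.le⟩).hasDerivWithinAt : HasDerivWithinAt q 0 (Ici s) s))
  have hqa : q a = ℓ := by
    simp only [hq, hu, hw, hℓ]
    rw [div_self (hw0 a ⟨le_rfl, hab⟩), one_smul]
  have hqt : q t = ℓ := (hconst t ht).trans hqa
  -- conclude
  have hr0 : u t / w t ≠ 0 := by
    intro h0
    have : q t = 0 := by simp only [hq]; rw [h0, zero_smul]
    exact hne a ⟨le_rfl, hab⟩ (by rw [← hℓ, ← hqt, this])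
  refine ⟨(u t / w t)⁻¹, inv_ne_zero hr0, ?_⟩
  rw [← hqt]
  simp only [hq]
  rw [smul_smul, inv_mul_cancel₀ hr0, one_smul]

end Direction

section DirectionNormed

variable {E : Type*} [NormedAddCommGroup E] [NormedSpace ℝ E] [FiniteDimensional ℝ E]

/-- **A nowhere-vanishing curve with `β' = c β` has constant direction** (finite-dimensional
normed space; transported from the inner-product form through `toEuclidean`). [folklore] -/
theorem exists_ne_zero_smul_of_hasDerivAt_smul {β : ℝ → E} {c : ℝ → ℝ} {a b : ℝ}
    (hβ : ∀ t ∈ Icc a b, HasDerivAt β (c t • β t) t) (hne : ∀ t ∈ Icc a b, β t ≠ 0)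
    {t : ℝ} (ht : t ∈ Icc a b) : ∃ μ : ℝ, μ ≠ 0 ∧ β t = μ • β a := by
  set L := (toEuclidean (E := E)) with hL
  have hβL : ∀ s ∈ Icc a b, HasDerivAt (fun s ↦ L (β s)) (c s • L (β s)) s := by
    intro s hs
    have h := (L : E →L[ℝ] EuclideanSpace ℝ (Fin (Module.finrank ℝ E))).hasFDerivAt.comp_hasDerivAt
      s (hβ s hs)
    rw [ContinuousLinearEquiv.coe_coe, map_smul] at h
    exact h
  have hneL : ∀ s ∈ Icc a b, L (β s) ≠ 0 := fun s hs h0 ↦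
    hne s hs (L.injective (by rw [h0, map_zero]))
  obtain ⟨μ, hμ, hμeq⟩ := exists_ne_zero_smul_of_hasDerivAt_smul_inner hβL hneL ht
  refine ⟨μ, hμ, L.injective ?_⟩
  rw [hμeq, map_smul]

/-- **Monotone representation on a zero-free interval.** Let `β' t` be a positive multiple of
`β t` at every `t ∈ [a, b]` and `β t ≠ 0` there. Then `β t = μ(t) β a` with `μ` continuous,
strictly increasing on `[a, b]`, `μ(a) = 1` (so `μ ≥ 1`), differentiable with
`μ' t = c(t) μ(t)` where `β' t = c(t) β t`. [folklore] -/
theorem exists_strictMonoOn_repr_of_forall_ne_zero {β β' : ℝ → E} {a b : ℝ} (hab : a ≤ b)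
    (hβ : ∀ t ∈ Icc a b, HasDerivAt β (β' t) t)
    (hdir : ∀ t ∈ Icc a b, ∃ c : ℝ, 0 < c ∧ β' t = c • β t) (hne : ∀ t ∈ Icc a b, β t ≠ 0) :
    ∃ μ : ℝ → ℝ, μ a = 1 ∧ ContinuousOn μ (Icc a b) ∧ StrictMonoOn μ (Icc a b) ∧
      (∀ t ∈ Icc a b, β t = μ t • β a) ∧ (∀ t ∈ Icc a b, 1 ≤ μ t) := by
  classical
  -- the coefficient function `c`
  have hdir' : ∀ t, ∃ c : ℝ, t ∈ Icc a b → 0 < c ∧ β' t = c • β t := fun t ↦ by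
    by_cases ht : t ∈ Icc a b
    · obtain ⟨c, hc, h⟩ := hdir t ht; exact ⟨c, fun _ ↦ ⟨hc, h⟩⟩
    · exact ⟨1, fun h ↦ (ht h).elim⟩
  choose c hc using hdir'
  have hβc : ∀ t ∈ Icc a b, HasDerivAt β (c t • β t) t := fun t ht ↦ by
    rw [← (hc t ht).2]; exact hβ t ht
  -- a functional normalised on `ℓ = β a`
  set ℓ := β a with hℓ
  have hℓ0 : ‖ℓ‖ ≠ 0 := norm_ne_zero_iff.2 (hne a ⟨le_rfl, hab⟩)
  obtain ⟨φ, -, hφℓ⟩ := exists_dual_vector ℝ ℓ hℓ0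
  have hφℓ0 : φ ℓ ≠ 0 := by rw [hφℓ]; exact_mod_cast hℓ0
  set μ : ℝ → ℝ := fun t ↦ φ (β t) / φ ℓ with hμ
  -- `β t = μ t • ℓ`
  have hrepr : ∀ t ∈ Icc a b, β t = μ t • ℓ := by
    intro t ht
    obtain ⟨m, -, hm⟩ := exists_ne_zero_smul_of_hasDerivAt_smul hβc hne ht
    have hμm : μ t = m := by
      simp only [hμ]
      rw [hm, map_smul, smul_eq_mul, mul_div_assoc, div_self hφℓ0, mul_one]
    rw [hμm, hm]
  have hμa : μ a = 1 := by simp only [hμ]; exact div_self hφℓ0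
  -- derivative and continuity of `μ`
  have hμ' : ∀ t ∈ Icc a b, HasDerivAt μ (c t * μ t) t := by
    intro t ht
    have h := ((φ : E →L[ℝ] ℝ).hasFDerivAt.comp_hasDerivAt t (hβc t ht)).div_const (φ ℓ)
    have h2 : φ (c t • β t) / φ ℓ = c t * μ t := by
      rw [map_smul, smul_eq_mul, mul_div_assoc]
    rw [h2] at h
    exact h
  have hμc : ContinuousOn μ (Icc a b) := fun t ht ↦ (hμ' t ht).continuousAt.continuousWithinAt
  -- `μ` never vanishes, hence is positive (IVT)
  have hμ0 : ∀ t ∈ Icc a b, μ t ≠ 0 := by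
    intro t ht h0
    have : β t = 0 := by rw [hrepr t ht, h0, zero_smul]
    exact hne t ht this
  have hμpos : ∀ t ∈ Icc a b, 0 < μ t := by
    intro t ht
    by_contra hneg
    push Not at hneg
    have hivt := intermediate_value_Icc' ht.1 (hμc.mono (Icc_subset_Icc le_rfl ht.2))
    have h0 : (0 : ℝ) ∈ Icc (μ t) (μ a) := ⟨hneg, by rw [hμa]; exact zero_le_one⟩
    obtain ⟨s, hs, hs0⟩ := hivt h0
    exact hμ0 s ⟨hs.1, hs.2.trans ht.2⟩ hs0
  -- strictly increasing
  have hmono : StrictMonoOn μ (Icc a b) := by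
    refine strictMonoOn_of_deriv_pos (convex_Icc a b) hμc fun s hs ↦ ?_
    rw [interior_Icc] at hs
    have hs' : s ∈ Icc a b := ⟨hs.1.le, hs.2.le⟩
    rw [(hμ' s hs').deriv]
    exact mul_pos (hc s hs').1 (hμpos s hs')
  refine ⟨μ, hμa, hμc, hmono, hrepr, fun t ht ↦ ?_⟩
  rw [← hμa]
  exact hmono.monotoneOn ⟨le_rfl, hab⟩ ht ht.1

/-- **No zero can be reached along a curve with `β' ∈ ℝ_{>0} β`.** If `β a ≠ 0` and at every
point of `[a, b]` where `β ≠ 0` the derivative is a positive multiple of `β`, then `β` has no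
zero on `[a, b]` (along a zero-free initial segment `‖β‖ ≥ ‖β a‖` by the monotone representation,
and this bound passes to the limit; continuous induction). [folklore] -/
theorem forall_ne_zero_of_hasDerivAt_of_dir {β β' : ℝ → E} {a b : ℝ}
    (hβ : ∀ t ∈ Icc a b, HasDerivAt β (β' t) t)
    (hdir : ∀ t ∈ Icc a b, β t ≠ 0 → ∃ c : ℝ, 0 < c ∧ β' t = c • β t) (ha : β a ≠ 0) :
    ∀ t ∈ Icc a b, β t ≠ 0 := by
  have hβc : ∀ t ∈ Icc a b, ContinuousAt β t := fun t ht ↦ (hβ t ht).continuousAt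
  -- norm bound along a zero-free initial segment
  have hbound : ∀ t ∈ Icc a b, (∀ s ∈ Icc a t, β s ≠ 0) → ‖β a‖ ≤ ‖β t‖ := by
    intro t ht hzf
    have hsub : Icc a t ⊆ Icc a b := Icc_subset_Icc le_rfl ht.2
    obtain ⟨μ, -, -, -, hrepr, hge⟩ := exists_strictMonoOn_repr_of_forall_ne_zero ht.1
      (fun s hs ↦ hβ s (hsub hs)) (fun s hs ↦ hdir s (hsub hs) (hzf s hs)) hzf
    rw [hrepr t ⟨ht.1, le_rfl⟩, norm_smul, Real.norm_eq_abs,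
      abs_of_pos (lt_of_lt_of_le zero_lt_one (hge t ⟨ht.1, le_rfl⟩))]
    have := hge t ⟨ht.1, le_rfl⟩
    nlinarith [norm_nonneg (β a)]
  have hna : 0 < ‖β a‖ := norm_pos_iff.2 ha
  -- continuous induction on `S = {t | β ≠ 0 on [a, t] ∩ (-∞, b]}`
  set S : Set ℝ := {t | ∀ s ∈ Icc a t, s ≤ b → β s ≠ 0} with hS
  have hSa : a ∈ S := fun s hs _ ↦ by rw [le_antisymm hs.2 hs.1]; exact ha
  suffices h : Icc a b ⊆ S from fun t ht ↦ h ht t ⟨ht.1, le_rfl⟩ ht.2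
  -- closure step: if `β ≠ 0` on `[a, t)` then `β t ≠ 0`
  have hclos : ∀ t ∈ Icc a b, (∀ s ∈ Ico a t, β s ≠ 0) → β t ≠ 0 := by
    intro t ht hgood
    rcases eq_or_lt_of_le ht.1 with h | hat'
    · rw [← h]; exact ha
    -- `‖β s‖ ≥ ‖β a‖` for `s ∈ [a, t)`, hence at `t`
    have hge : ∀ s ∈ Ico a t, ‖β a‖ ≤ ‖β s‖ := fun s hs ↦
      hbound s ⟨hs.1, hs.2.le.trans ht.2⟩ fun s' hs' ↦ hgood s' ⟨hs'.1, lt_of_le_of_lt hs'.2 hs.2⟩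
    have hle : ‖β a‖ ≤ ‖β t‖ := by
      have hcont : ContinuousWithinAt (fun s ↦ ‖β s‖) (Ico a t) t :=
        ((continuous_norm.continuousAt).comp (hβc t ht)).continuousWithinAt
      have hmem : t ∈ closure (Ico a t) := by
        rw [closure_Ico hat'.ne]; exact ⟨hat'.le, le_rfl⟩
      exact ContinuousWithinAt.closure_le (f := fun _ ↦ ‖β a‖) (g := fun s ↦ ‖β s‖) hmem
        continuousWithinAt_const hcont hge
    exact norm_pos_iff.1 (hna.trans_le hle)
  refine IsClosed.Icc_subset_of_forall_exists_gt ?_ hSa ?_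
  · rw [← closure_subset_iff_isClosed]
    intro t ht
    have htab : t ∈ Icc a b :=
      (closure_Icc a b).subset (closure_mono inter_subset_right ht)
    refine ⟨fun s hs hsb ↦ ?_, htab⟩
    rcases hs.2.lt_or_eq with hst | h
    · rw [Metric.mem_closure_iff] at ht
      obtain ⟨t', ht'S, hdist⟩ := ht (t - s) (by linarith)
      have hst' : s ≤ t' := by
        rw [Real.dist_eq] at hdist
        have := abs_lt.1 hdist
        linarith [this.1, this.2]
      exact ht'S.1 s ⟨hs.1, hst'⟩ hsb
    · rw [h]
      refine hclos t htab fun s' hs' ↦ ?_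
      rw [Metric.mem_closure_iff] at ht
      obtain ⟨t', ht'S, hdist⟩ := ht (t - s') (by linarith [hs'.2])
      have hst' : s' ≤ t' := by
        rw [Real.dist_eq] at hdist
        have := abs_lt.1 hdist
        linarith [this.1, this.2]
      exact ht'S.1 s' ⟨hs'.1, hst'⟩ (by linarith [hs'.2, htab.2])
  · rintro t ⟨htS, hta, htb⟩ y hy
    have htne : β t ≠ 0 := htS t ⟨hta, le_rfl⟩ htb.le
    have hev : ∀ᶠ s in 𝓝 t, β s ≠ 0 :=
      (hβc t ⟨hta, htb.le⟩).preimage_mem_nhds (isOpen_ne.mem_nhds htne)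
    obtain ⟨δ, hδ, hball⟩ := Metric.eventually_nhds_iff.1 hev
    set t' := min (min (t + δ / 2) b) y with ht'
    have htt' : t < t' := by
      simp only [ht', lt_min_iff]; exact ⟨⟨by linarith, htb⟩, hy⟩
    refine ⟨t', ⟨fun s hs hsb ↦ ?_, htt', min_le_right _ _⟩⟩
    rcases le_or_gt s t with hst | hst
    · exact htS s ⟨hs.1, hst⟩ hsb
    · refine hball ?_
      rw [Real.dist_eq, abs_lt]
      have h1 : s ≤ t + δ / 2 := hs.2.trans ((min_le_left _ _).trans (min_le_left _ _))
      constructor <;> linarith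

end DirectionNormed

/-! ### Null rigidity in the exponential chart -/

section Lorentz

variable {E : Type*} [NormedAddCommGroup E] [NormedSpace ℝ E] {H : Type*} [TopologicalSpace H]
  {I : ModelWithCorners ℝ E H} {M : Type*} [TopologicalSpace M] [ChartedSpace H M]
  [IsManifold I ∞ M] [FiniteDimensional ℝ E] [CompleteSpace E] [T2Space M]
  [BoundarylessManifold I M]
  {n : ℕ∞ω} {g : LorentzianMetric I n M} [g.HasLeviCivita]
  [CovariantDerivative.ContMDiffCovariantDerivative g.leviCivita 1] (τ : TimeOrientation g)

/-- **Null rigidity in the exponential chart** (the rigidity half of O'Neill 1983, Ch. 10,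
Prop. 10.46, local differentiable form; cf. Ch. 5, Lemma 5.33, causal case). Let
`β : [a, b] → 𝓔_o ⊆ T_oM` (`a < b`) be differentiable with `α = exp_o ∘ β` future causal, `β`
valued in the closed future causal cone, `β a = 0`, `d(exp_o)_{β t}` injective for all `t`, and
`g_o(β b, β b) = 0`. Then there are a future null `ℓ ∈ T_oM` and `θ : [a, b] → ℝ` continuous,
strictly increasing, `θ a = 0`, with `β t = θ(t) ℓ` on `[a, b]`, and every `β' t` (`t ∈ [a, b]`)
is a positive multiple of `ℓ`. Proof: `g_o(β, β) ≡ 0` (`radial_causalcone_antitone`), so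
`0 = g_o(β', β) = g(α', P)` (Gauss lemma) and `α' = c P`, `c > 0` (equality in the reverse
Cauchy–Schwarz inequality), i.e. `β' = c β` wherever `β ≠ 0`; such a curve cannot reach `0` again
(`forall_ne_zero_of_hasDerivAt_of_dir`) nor sit at `0` on an interval (`α' ≠ 0`), and keeps a
constant direction (`exists_ne_zero_smul_of_hasDerivAt_smul`).
[cite: ONeillSemiRiemannian1983, Ch. 10, Prop. 10.46 (p. 294); Ch. 5, Lemma 5.33 (p. 147)] -/
theorem radial_null_rigidity (hn : (∞ : ℕ∞ω) ≤ n) {o : M} {β β' : ℝ → E} {a b : ℝ} (hab : a < b)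
    (hβ : ∀ t ∈ Icc a b, HasDerivAt β (β' t) t)
    (hdom : ∀ t ∈ Icc a b, (β t : TangentSpace I o) ∈ expDomain g.leviCivita o)
    (hfut : ∀ t ∈ Icc a b,
      τ.IsFutureDirected (velocity I (fun s ↦ expMap g.leviCivita o (β s)) t))
    (hcone : ∀ t ∈ Icc a b, g.val o (β t) (β t) ≤ 0 ∧ g.val o (τ.vectorField o) (β t) ≤ 0)
    (hinj : ∀ t ∈ Icc a b,
      Injective (mfderiv 𝓘(ℝ, E) I (fun u : E ↦ expMap g.leviCivita o u) (β t)))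
    (ha0 : β a = 0) (hfb : g.val o (β b) (β b) = 0) :
    ∃ (ℓ : E) (θ : ℝ → ℝ), g.IsNull (x := o) ℓ ∧ τ.IsFutureDirected (x := o) ℓ ∧ θ a = 0 ∧
      ContinuousOn θ (Icc a b) ∧ StrictMonoOn θ (Icc a b) ∧ (∀ t ∈ Icc a b, β t = θ t • ℓ) ∧
      (∀ t ∈ Icc a b, ∃ c : ℝ, 0 < c ∧ β' t = c • ℓ) := by
  classical
  haveI : Fact (1 ≤ n) := ⟨le_trans (by exact_mod_cast le_top) hn⟩
  set f : ℝ → ℝ := fun t ↦ g.val o (β t) (β t) with hf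
  set D : ℝ → E →L[ℝ] E := fun t ↦
    mfderiv 𝓘(ℝ, E) I (fun u : E ↦ expMap g.leviCivita o u) (β t) with hD
  have hT : g.IsTimelike (τ.vectorField o) := τ.isTimelike o
  have hβc : ∀ t ∈ Icc a b, ContinuousAt β t := fun t ht ↦ (hβ t ht).continuousAt
  -- (1) `f ≡ 0` on `[a, b]`
  obtain ⟨-, hanti⟩ := radial_causalcone_antitone τ hn hβ hdom hfut hcone
  have hf0 : ∀ t ∈ Icc a b, f t = 0 := fun t ht ↦
    le_antisymm (hcone t ht).1 (by
      have h : f b ≤ f t := hanti ht ⟨hab.le, le_rfl⟩ ht.2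
      have hb0 : f b = 0 := hfb
      linarith)
  -- (2) `g_o(β', β) = 0` on `[a, b]`
  have hf' : ∀ t ∈ Icc a b, HasDerivAt f (2 * g.val o (β' t) (β t)) t := fun t ht ↦
    hasDerivAt_val_self_comp o (hβ t ht)
  have horth : ∀ t ∈ Icc a b, g.val o (β' t) (β t) = 0 := by
    intro t ht
    have h1 : HasDerivWithinAt f (2 * g.val o (β' t) (β t)) (Icc a b) t :=
      (hf' t ht).hasDerivWithinAt
    have h2 : HasDerivWithinAt f 0 (Icc a b) t :=
      (hasDerivWithinAt_const t (Icc a b) (0 : ℝ)).congr_of_mem (fun s hs ↦ hf0 s hs) ht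
    have := (uniqueDiffOn_Icc hab t ht).eq_deriv _ h1 h2
    linarith
  -- (3) where `β ≠ 0`: `β' = c β` with `c > 0`
  have hdir : ∀ t ∈ Icc a b, β t ≠ 0 → ∃ c : ℝ, 0 < c ∧ β' t = c • β t := by
    intro t ht h0
    have hcausal : g.IsCausal (x := o) (β t) := ⟨(hcone t ht).1, h0⟩
    have hfd : τ.IsFutureDirected (x := o) (β t) :=
      ⟨hcausal, lt_of_le_of_ne (hcone t ht).2 (g.val_ne_zero_of_isTimelike_of_isCausal hT hcausal)⟩
    have hnull : g.IsNull (x := o) (β t) := ⟨hf0 t ht, h0⟩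
    have hP := isNull_isFutureDirected_velocity_expMap_smul τ hnull hfd (s := 1) (hdom t ht).2
    rw [one_smul] at hP
    have hG := val_deriv_self_eq_val_velocity_radial hn o (hβ t ht) (hdom t ht)
    rw [horth t ht, g.symm] at hG
    obtain ⟨c, hc, hcP⟩ :=
      TimeOrientation.IsFutureDirected.exists_pos_smul_eq_of_val_eq_zero hP.2 (hfut t ht) hG.symm
    refine ⟨c, hc, hinj t ht ?_⟩
    have h1 : D t (β' t) = velocity I (fun s ↦ expMap g.leviCivita o (β s)) t :=
      (velocity_expMap_comp (cov := g.leviCivita) o (hβ t ht) (hdom t ht)).symm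
    have h2 : (c • velocity I (fun r : ℝ ↦ expMap g.leviCivita o
        ((r • β t : E) : TangentSpace I o)) 1 : E) = c • D t (β t) := by
      rw [velocity_expMap_smul_one (cov := g.leviCivita) o (hdom t ht)]
      rfl
    show D t (β' t) = D t (c • β t)
    rw [map_smul, h1, hcP]
    exact h2
  -- (4) `β ≠ 0` on `(a, b]`
  have hnz : ∀ t ∈ Ioc a b, β t ≠ 0 := by
    intro t ht h0
    have htab : t ∈ Icc a b := ⟨ht.1.le, ht.2⟩
    by_cases hex : ∃ t₁ ∈ Ioo a t, β t₁ ≠ 0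
    · obtain ⟨t₁, ht₁, hne₁⟩ := hex
      have hsub : Icc t₁ t ⊆ Icc a b := Icc_subset_Icc ht₁.1.le ht.2
      exact forall_ne_zero_of_hasDerivAt_of_dir (fun s hs ↦ hβ s (hsub hs))
        (fun s hs ↦ hdir s (hsub hs)) hne₁ t ⟨ht₁.2.le, le_rfl⟩ h0
    · push Not at hex
      -- `β = 0` on `(a, t)`: the curve is constant there, contradicting `α' ≠ 0`
      set m : ℝ := (a + t) / 2 with hm
      have hm' : m ∈ Ioo a t := ⟨by rw [hm]; linarith [ht.1], by rw [hm]; linarith [ht.1]⟩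
      have hev : (fun s ↦ expMap g.leviCivita o (β s)) =ᶠ[𝓝 m] fun _ ↦ o := by
        filter_upwards [isOpen_Ioo.mem_nhds hm'] with s hs
        rw [hex s hs]
        exact expMap_zero (cov := g.leviCivita) o
      have hvel : velocity I (fun s ↦ expMap g.leviCivita o (β s)) m = 0 := by
        rw [velocity_congr_of_eventuallyEq (I := I) hev]
        exact velocity_const (I := I) o m
      exact (hfut m ⟨hm'.1.le, hm'.2.le.trans ht.2⟩).1.2 hvel
  -- (5) the direction `ℓ = β t₁`, a future null vector
  set t₁ : ℝ := (a + b) / 2 with ht₁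
  have ht₁' : t₁ ∈ Ioo a b := ⟨by rw [ht₁]; linarith, by rw [ht₁]; linarith⟩
  have ht₁ab : t₁ ∈ Icc a b := ⟨ht₁'.1.le, ht₁'.2.le⟩
  set ℓ : E := β t₁ with hℓ
  have hℓne : ℓ ≠ 0 := hnz t₁ ⟨ht₁'.1, ht₁'.2.le⟩
  have hℓnull : g.IsNull (x := o) ℓ := ⟨hf0 t₁ ht₁ab, hℓne⟩
  have hℓfd : τ.IsFutureDirected (x := o) ℓ :=
    ⟨hℓnull.isCausal, lt_of_le_of_ne (hcone t₁ ht₁ab).2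
      (g.val_ne_zero_of_isTimelike_of_isCausal hT hℓnull.isCausal)⟩
  -- the global coefficient function `c` and `β' = c β` off `t = a`
  have hdir' : ∀ t, ∃ c : ℝ, (t ∈ Icc a b ∧ β t ≠ 0) → 0 < c ∧ β' t = c • β t := fun t ↦ by
    by_cases h : t ∈ Icc a b ∧ β t ≠ 0
    · obtain ⟨c, hc, hc'⟩ := hdir t h.1 h.2; exact ⟨c, fun _ ↦ ⟨hc, hc'⟩⟩
    · exact ⟨1, fun h' ↦ (h h').elim⟩
  choose c hc using hdir'
  have hβc' : ∀ t ∈ Ioc a b, HasDerivAt β (c t • β t) t := fun t ht ↦ by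
    rw [← (hc t ⟨⟨ht.1.le, ht.2⟩, hnz t ht⟩).2]; exact hβ t ⟨ht.1.le, ht.2⟩
  -- every `β t` is a multiple of `ℓ`
  have hpar : ∀ t ∈ Icc a b, ∃ m : ℝ, β t = m • ℓ := by
    intro t ht
    rcases eq_or_lt_of_le ht.1 with h | hat
    · exact ⟨0, by rw [← h, ha0, zero_smul]⟩
    rcases le_total t t₁ with htt | htt
    · -- on `[t, t₁]`
      have hsub : Icc t t₁ ⊆ Ioc a b := fun s hs ↦ ⟨hat.trans_le hs.1, hs.2.trans ht₁'.2.le⟩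
      obtain ⟨m, hm, hmeq⟩ := exists_ne_zero_smul_of_hasDerivAt_smul
        (fun s hs ↦ hβc' s (hsub hs)) (fun s hs ↦ hnz s (hsub hs)) (t := t₁) ⟨htt, le_rfl⟩
      refine ⟨m⁻¹, ?_⟩
      rw [hℓ, hmeq, smul_smul, inv_mul_cancel₀ hm, one_smul]
    · -- on `[t₁, t]`
      have hsub : Icc t₁ t ⊆ Ioc a b := fun s hs ↦ ⟨ht₁'.1.trans_le hs.1, hs.2.trans ht.2⟩
      obtain ⟨m, -, hmeq⟩ := exists_ne_zero_smul_of_hasDerivAt_smul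
        (fun s hs ↦ hβc' s (hsub hs)) (fun s hs ↦ hnz s (hsub hs)) (t := t) ⟨htt, le_rfl⟩
      exact ⟨m, hmeq⟩
  -- the coefficient as a differentiable function: `θ = φ ∘ β / φ ℓ`
  have hℓ0 : ‖ℓ‖ ≠ 0 := norm_ne_zero_iff.2 hℓne
  obtain ⟨φ, -, hφℓ⟩ := exists_dual_vector ℝ ℓ hℓ0
  have hφℓ0 : φ ℓ ≠ 0 := by rw [hφℓ]; exact_mod_cast hℓ0
  set θ : ℝ → ℝ := fun t ↦ φ (β t) / φ ℓ with hθ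
  have hrepr : ∀ t ∈ Icc a b, β t = θ t • ℓ := by
    intro t ht
    obtain ⟨m, hm⟩ := hpar t ht
    have : θ t = m := by
      simp only [hθ]
      rw [hm, map_smul, smul_eq_mul, mul_div_assoc, div_self hφℓ0, mul_one]
    rw [this, hm]
  have hθa : θ a = 0 := by simp only [hθ]; rw [ha0, map_zero, zero_div]
  have hθ₁ : θ t₁ = 1 := by simp only [hθ]; exact div_self hφℓ0
  set θ' : ℝ → ℝ := fun t ↦ φ (β' t) / φ ℓ with hθ'
  have hθd : ∀ t ∈ Icc a b, HasDerivAt θ (θ' t) t := fun t ht ↦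
    ((φ : E →L[ℝ] ℝ).hasFDerivAt.comp_hasDerivAt t (hβ t ht)).div_const (φ ℓ)
  have hθc : ContinuousOn θ (Icc a b) := fun t ht ↦ (hθd t ht).continuousAt.continuousWithinAt
  -- `θ > 0` on `(a, b]`
  have hθne : ∀ t ∈ Ioc a b, θ t ≠ 0 := by
    intro t ht h0
    have : β t = 0 := by rw [hrepr t ⟨ht.1.le, ht.2⟩, h0, zero_smul]
    exact hnz t ht this
  have hθpos : ∀ t ∈ Ioc a b, 0 < θ t := by
    intro t ht
    by_contra hneg
    push Not at hneg
    rcases le_total t t₁ with htt | htt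
    · have hcont : ContinuousOn θ (Icc t t₁) :=
        hθc.mono (Icc_subset_Icc ht.1.le ht₁'.2.le)
      have h0 : (0 : ℝ) ∈ Icc (θ t) (θ t₁) := ⟨hneg, by rw [hθ₁]; exact zero_le_one⟩
      obtain ⟨s, hs, hs0⟩ := intermediate_value_Icc htt hcont h0
      exact hθne s ⟨ht.1.trans_le hs.1, hs.2.trans ht₁'.2.le⟩ hs0
    · have hcont : ContinuousOn θ (Icc t₁ t) :=
        hθc.mono (Icc_subset_Icc ht₁'.1.le ht.2)
      have h0 : (0 : ℝ) ∈ Icc (θ t) (θ t₁) := ⟨hneg, by rw [hθ₁]; exact zero_le_one⟩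
      obtain ⟨s, hs, hs0⟩ := intermediate_value_Icc' htt hcont h0
      exact hθne s ⟨ht₁'.1.trans_le hs.1, hs.2.trans ht.2⟩ hs0
  -- `θ` is strictly increasing: `θ' = c θ > 0` inside
  have hθ'eq : ∀ t ∈ Ioc a b, θ' t = c t * θ t := by
    intro t ht
    simp only [hθ', hθ]
    rw [(hc t ⟨⟨ht.1.le, ht.2⟩, hnz t ht⟩).2, map_smul, smul_eq_mul, mul_div_assoc]
  have hmono : StrictMonoOn θ (Icc a b) := by
    refine strictMonoOn_of_deriv_pos (convex_Icc a b) hθc fun s hs ↦ ?_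
    rw [interior_Icc] at hs
    rw [(hθd s ⟨hs.1.le, hs.2.le⟩).deriv, hθ'eq s ⟨hs.1, hs.2.le⟩]
    exact mul_pos (hc s ⟨⟨hs.1.le, hs.2.le⟩, hnz s ⟨hs.1, hs.2.le⟩⟩).1 (hθpos s ⟨hs.1, hs.2.le⟩)
  -- derivatives: `β' t = θ' t • ℓ` with `θ' t > 0`
  have hder : ∀ t ∈ Icc a b, β' t = θ' t • ℓ := by
    intro t ht
    have h1 : HasDerivWithinAt β (β' t) (Icc a b) t := (hβ t ht).hasDerivWithinAt
    have h2 : HasDerivWithinAt (fun s ↦ θ s • ℓ) (θ' t • ℓ) (Icc a b) t :=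
      ((hθd t ht).smul_const ℓ).hasDerivWithinAt
    have h2' : HasDerivWithinAt β (θ' t • ℓ) (Icc a b) t :=
      h2.congr_of_mem (fun s hs ↦ hrepr s hs) ht
    exact (uniqueDiffOn_Icc hab t ht).eq_deriv _ h1 h2'
  have hθ'pos : ∀ t ∈ Icc a b, 0 < θ' t := by
    intro t ht
    have hne : θ' t ≠ 0 := by
      intro h0
      have hβ'0 : β' t = 0 := by rw [hder t ht, h0, zero_smul]
      have hvel : velocity I (fun s ↦ expMap g.leviCivita o (β s)) t = 0 := by
        rw [velocity_expMap_comp (cov := g.leviCivita) o (hβ t ht) (hdom t ht), hβ'0]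
        exact map_zero _
      exact (hfut t ht).1.2 hvel
    have hge : 0 ≤ θ' t := by
      rw [← (hθd t ht).hasDerivWithinAt.derivWithin (uniqueDiffOn_Icc hab t ht)]
      exact hmono.monotoneOn.derivWithin_nonneg
    exact lt_of_le_of_ne hge (Ne.symm hne)
  exact ⟨ℓ, θ, hℓnull, hℓfd, hθa, hθc, hmono, hrepr, fun t ht ↦ ⟨θ' t, hθ'pos t ht, hder t ht⟩⟩

/-- **Null rigidity, read on the manifold**: under the hypotheses of `radial_null_rigidity`,
`α = exp_o ∘ β` is a monotone reparametrisation of the radial null geodesic `σ(s) = exp_o(sℓ)`: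
`α t = σ(θ t)`, `θ(t) ℓ ∈ 𝓔_o`, and `α'(t)` is a positive multiple of `σ'(θ t)` for every
`t ∈ [a, b]` (chain rule through `exp_o`). O'Neill 1983, Ch. 10, Prop. 10.46 ("unless `α` is a null
pregeodesic"). [cite: ONeillSemiRiemannian1983, Ch. 10, Prop. 10.46 (p. 294)] -/
theorem radial_null_rigidity_velocity (hn : (∞ : ℕ∞ω) ≤ n) {o : M} {β β' : ℝ → E} {a b : ℝ}
    (hab : a < b) (hβ : ∀ t ∈ Icc a b, HasDerivAt β (β' t) t)
    (hdom : ∀ t ∈ Icc a b, (β t : TangentSpace I o) ∈ expDomain g.leviCivita o)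
    (hfut : ∀ t ∈ Icc a b,
      τ.IsFutureDirected (velocity I (fun s ↦ expMap g.leviCivita o (β s)) t))
    (hcone : ∀ t ∈ Icc a b, g.val o (β t) (β t) ≤ 0 ∧ g.val o (τ.vectorField o) (β t) ≤ 0)
    (hinj : ∀ t ∈ Icc a b,
      Injective (mfderiv 𝓘(ℝ, E) I (fun u : E ↦ expMap g.leviCivita o u) (β t)))
    (ha0 : β a = 0) (hfb : g.val o (β b) (β b) = 0) :
    ∃ (ℓ : E) (θ : ℝ → ℝ), g.IsNull (x := o) ℓ ∧ τ.IsFutureDirected (x := o) ℓ ∧ θ a = 0 ∧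
      ContinuousOn θ (Icc a b) ∧ StrictMonoOn θ (Icc a b) ∧
      (∀ t ∈ Icc a b, ((θ t • ℓ : E) : TangentSpace I o) ∈ expDomain g.leviCivita o ∧
        expMap g.leviCivita o (β t) = expMap g.leviCivita o ((θ t • ℓ : E) : TangentSpace I o)) ∧
      (∀ t ∈ Icc a b, ∃ c : ℝ, 0 < c ∧
        velocity I (fun s ↦ expMap g.leviCivita o (β s)) t =
          c • velocity I (fun r : ℝ ↦ expMap g.leviCivita o ((r • ℓ : E) : TangentSpace I o))
            (θ t)) := by
  obtain ⟨ℓ, θ, hℓn, hℓf, hθa, hθc, hmono, hrepr, hder⟩ :=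
    radial_null_rigidity τ hn hab hβ hdom hfut hcone hinj ha0 hfb
  refine ⟨ℓ, θ, hℓn, hℓf, hθa, hθc, hmono, fun t ht ↦ ?_, fun t ht ↦ ?_⟩
  · have h : ((θ t • ℓ : E) : TangentSpace I o) ∈ expDomain g.leviCivita o := by
      rw [← hrepr t ht]; exact hdom t ht
    exact ⟨h, by rw [← hrepr t ht]⟩
  · obtain ⟨c, hc, hc'⟩ := hder t ht
    refine ⟨c, hc, ?_⟩
    have hmem : ((θ t • ℓ : E) : TangentSpace I o) ∈ expDomain g.leviCivita o := by
      rw [← hrepr t ht]; exact hdom t ht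
    set Dt : E →L[ℝ] E := mfderiv 𝓘(ℝ, E) I (fun u : E ↦ expMap g.leviCivita o u) (β t)
      with hDt
    have e3 : Dt (β' t) = c • Dt ℓ := by rw [hc', map_smul]
    rw [velocity_expMap_comp (cov := g.leviCivita) o (hβ t ht) (hdom t ht),
      velocity_expMap_smul_eq_mfderiv (cov := g.leviCivita) o ℓ hmem, ← hrepr t ht]
    exact e3

end Lorentz

end Literature.Geometry.Lorentzian
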